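import Summits.QuantumFields.BalabanUV.T4Continuum.Support.ShellMeasureLinearizedConstraint
import Literature.MathematicalPhysics.QuantumFieldTheory.Balaban1983to89.B12LinearizAnalytic267

/-!
# `T4Continuum.ShellMeasureLinearizedReal` — (LR)_j, THE REAL-FORM JUNCTION: print's linearizing `D̃` of a
# REAL coarse field is REAL, solves the fixed-point equation OVER `ℝ`, and is Fréchet-differentiable OVER `ℝ` with
# derivative «real part ∘ DD̃ ∘ inclusion» — exactly the inputs `hfix` / `hD` of row S33
# `ShellMeasureLinearizedConstraint.substitution_linearizes` / `…_injOn` / `…_hasFDerivWithinAt`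
(cell `pub-balaban`, sub-cell `t4`, spine estimate NE7c (node U5b); row-NE7c OWNER lineage `b2b-balaban-t4-ne7c-p1`
(gen 27), route «SHELL MEASURE», leaf SM-L5 = (LR)_j under the owner's RULING T-NE7c-8 (journal `CLAIMS.log`
l.12176: the (LR)_j reading OF RECORD is the PARAMETER reading on FIBRES of the block average; its displayed residual
is the LINEARIZABILITY of the block average, B12 p. 267 TYPE, whose complex form is the tree leaf `B12Lineariz267`
and whose «REAL-FORM junction is NOT made» — row S33's own words); ADDITIVE — imports row S33 file 2
`ShellMeasureLinearizedConstraint` (p216585) and the Literature leaf `B12LinearizAnalytic267` only; modifies nothing;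
0 `def`, 0 `def … : Prop`, 0 sorry, 0 citation of our own)

HONEST FRAMING.  Finite four-torus programme, rung (B)+1 only — NOT infinite volume, NOT a mass gap, NOT the Clay
problem, NOT summit progress; (B), `BetaPertHyp`, (B^μ) are not consumed.  NE7c (`T4IndicatorShell.ShellWeightBound`)
is NOT PRINTED and NOT PROVED; «NE7c ⇐ the named binders» (trigger c3).  This file is [folklore] functional analysis
(a retraction onto a closed real form + Banach's fixed point restricted to it + `restrictScalars` of a Fréchet
derivative); the printed device ([Balaban1987RG1] p. 267 «B′ = B − hD̃(B)») enters ONLY through the tree leaves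
`B12Lineariz267` / `B12LinearizAnalytic267` BY NAME (`exists_Dt`, `Dt_mem_of_mapsTo`, `eq_Dt_of_fixedPt`,
`norm_Dt_le`, `hasStrictFDerivAt_Dt`), nothing of them is re-derived, nothing printed is asserted.  HONEST DEPENDENCY
(cell, verbatim): continuum YM on T⁴ ⇐ BetaPertH ∧ nine spine estimates (0/9 proved); BetaPertH ⇐ (D1) ∧ (D4) ∧
CAP+tail; G-an2-4 gates asym, D1 and NE2/3/4.

THE POINT.  Row S33 (`ShellMeasureLinearizedConstraint` §2) turns print's substitution into the curved fibre chart of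
the (LR)_j window from REAL data: `L : E →L[ℝ] F` (print's `LQ̃`), `h : F →L[ℝ] E` («LQ̃h = I»), `Ct Dt : E → F` with
the fixed-point equation `hfix : ∀ B ∈ O, Ct (B − h (Dt B)) = Dt B` and, for the Jacobian, `HasFDerivWithinAt Dt …`.
The tree supplies `D̃` over COMPLEXIFIED spaces (`B12Lineariz267.exists_Dt`: complex Banach `𝒴`, `𝒳`, `QuadAnalytic
C̃ C₂ R`, `‖hX‖ ≤ b‖X‖`, `9C₂bε < 1`, `3ε ≤ R`) and its complex-analyticity (`B12LinearizAnalytic267`).  THIS FILE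
makes the junction: a REAL STRUCTURE = real normed spaces `E`, `F` with continuous `ℝ`-linear inclusions
`jE : E →L[ℝ] 𝒴`, `jF : F →L[ℝ] 𝒳`, a continuous `ℝ`-linear retraction `pF : 𝒳 →L[ℝ] F` of `jF` («real part»), and
real maps `h : F →L[ℝ] E`, `Ctr : E → F` INTERTWINED with the complex data (`hop (jF x) = jE (h x)`,
`Ct (jE y) = jF (Ctr y)` — print's `h` and `C̃` are real on real fields; displayed STRUCTURE, no estimate).  Then:
* §1 the real form `range jF` is CLOSED (it is the equaliser of `jF ∘ pF` and `id`), `jF` is injective, and the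
  contraction `X ↦ C̃(jE B − hX)` preserves it; hence (`Dt_mem_of_mapsTo`) **`D̃(jE B) ∈ range jF`** for
  `‖jE B‖ < ε` (`Dt_real_mem_range`) and `jF (pF (D̃ (jE B))) = D̃ (jE B)` (`jF_realDt`).
* §2 THE REAL FIXED-POINT EQUATION **`Ctr (B − h (pF (D̃ (jE B)))) = pF (D̃ (jE B))`** on the real window
  `‖jE B‖ < ε` (`realDt_fixedPt` — S33's `hfix` with `Dt := pF ∘ D̃ ∘ jE`), the quadratic bound
  `‖jF (realDt B)‖ ≤ 4C₂‖jE B‖²` (`norm_jF_realDt_le`), UNIQUENESS among real solutions in the ball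
  (`realDt_unique`), injectivity of the real substitution on the window (`real_substitution_injOn`, S33's
  `substitution_injOn` BY NAME) and the real linearization identity (`real_substitution_linearizes`,
  `B12Lineariz267.linearizes` over `ℝ` BY NAME).
* §3 THE REAL DERIVATIVE: under `C̃` analytic (`AnalyticOnNhd ℂ`) and `𝒴` complete, `pF ∘ D̃ ∘ jE` has the real
  Fréchet derivative `pF ∘L (DD̃(jE B)).restrictScalars ℝ ∘L jE` at every point of the real window
  (`hasFDerivAt_realDt`, from `B12LinearizAnalytic267.hasStrictFDerivAt_Dt`), hence `HasFDerivWithinAt` on the window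
  (`hasFDerivWithinAt_realDt` — S33's input for `substitution_hasFDerivWithinAt`).
* §4 THE END `exists_realDt`: from the complex hypotheses of `B12Lineariz267.exists_Dt` + the real structure, ONE real
  map `Dtr : E → F` with (fixed point ∧ bound ∧ real derivative) on the window; `exists_realDt_ball`: with `jE`
  norm-preserving the window is LITERALLY `ball 0 ε`.
WHAT REMAINS DISPLAYED (c3).  That Bałaban's block average about the step's background IS `LQ̃ + C̃` with `C̃`
quadratic-analytic in the contraction regime (B12 p. 267 / [15] Sect. C TYPE) and real on real fields; the slot
density's identification ([dict]); E2′'s SM-L1…L6 in the fibre coordinate.  No estimate; (M1), NE7c NOT proved;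
spine PROVED 0/9.
-/

noncomputable section

open Set Metric Function

namespace Summit.QuantumFields.BalabanUV.T4Continuum.ShellMeasureLinearizedReal

open Literature.MathematicalPhysics.QuantumFieldTheory.Balaban1983to89
open B13Contraction113 (QuadAnalytic)
open B12Lineariz267 (exists_Dt eq_Dt_of_fixedPt Dt_mem_of_mapsTo norm_Dt_le)
open B12LinearizAnalytic267 (hasStrictFDerivAt_Dt)

variable {𝒳 𝒴 : Type*} [NormedAddCommGroup 𝒳] [NormedSpace ℂ 𝒳] [CompleteSpace 𝒳]
  [NormedAddCommGroup 𝒴] [NormedSpace ℂ 𝒴]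
variable {E F : Type*} [NormedAddCommGroup E] [NormedSpace ℝ E] [NormedAddCommGroup F] [NormedSpace ℝ F]

/-! ## §1 The real form: a closed, injectively embedded real subspace with a retraction -/

section RealForm

variable {jF : F →L[ℝ] 𝒳} {pF : 𝒳 →L[ℝ] F}

omit [CompleteSpace 𝒳] in
/-- A continuous linear map with a continuous linear RETRACTION is injective. [folklore] -/
theorem jF_injective (hpF : ∀ x, pF (jF x) = x) : Injective jF :=
  fun x y hxy => by simpa [hpF] using congrArg pF hxy

omit [CompleteSpace 𝒳] in
/-- The real form `range jF` is the equaliser `{X | jF (pF X) = X}`. [folklore] -/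
theorem range_eq_equalizer (hpF : ∀ x, pF (jF x) = x) :
    range (jF : F → 𝒳) = {X : 𝒳 | jF (pF X) = X} := by
  ext X
  constructor
  · rintro ⟨x, rfl⟩
    simp [hpF]
  · intro hX
    exact ⟨pF X, hX⟩

omit [CompleteSpace 𝒳] in
/-- **The real form is CLOSED** (an equaliser of two continuous maps). [folklore] -/
theorem isClosed_range (hpF : ∀ x, pF (jF x) = x) : IsClosed (range (jF : F → 𝒳)) := by
  rw [range_eq_equalizer hpF]
  exact isClosed_eq (jF.continuous.comp pF.continuous) continuous_id

omit [CompleteSpace 𝒳] in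
/-- On the real form the retraction is a two-sided inverse: `jF (pF X) = X` for `X ∈ range jF`. [folklore] -/
theorem jF_pF_of_mem (hpF : ∀ x, pF (jF x) = x) {X : 𝒳} (hX : X ∈ range (jF : F → 𝒳)) : jF (pF X) = X := by
  rw [range_eq_equalizer hpF] at hX
  exact hX

end RealForm

/-! ## §2 `D̃` of a real field is real; the real fixed-point equation, bound, uniqueness, injectivity, linearization -/

section RealFixedPoint

variable {hop : 𝒳 →ₗ[ℂ] 𝒴} {Ct : 𝒴 → 𝒳} {C₂ R b ε : ℝ} {Dt : 𝒴 → 𝒳}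
  {jE : E →L[ℝ] 𝒴} {jF : F →L[ℝ] 𝒳} {pF : 𝒳 →L[ℝ] F} {h : F →L[ℝ] E} {Ctr : E → F}

omit [CompleteSpace 𝒳] in
/-- **THE CONTRACTION PRESERVES THE REAL FORM**: with `hop (jF x) = jE (h x)` and `Ct (jE y) = jF (Ctr y)`, for a
real `B` the map `X ↦ C̃(jE B − hX)` sends `range jF` into itself. [folklore] -/
theorem mapsTo_realForm (hh : ∀ x, hop (jF x) = jE (h x)) (hC : ∀ y, Ct (jE y) = jF (Ctr y)) (B : E)
    {X : 𝒳} (hX : X ∈ range (jF : F → 𝒳)) : Ct (jE B - hop X) ∈ range (jF : F → 𝒳) := by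
  obtain ⟨x, rfl⟩ := hX
  refine ⟨Ctr (B - h x), ?_⟩
  rw [hh, ← map_sub, hC]

/-- **`D̃` OF A REAL COARSE FIELD IS REAL** (`B12Lineariz267.Dt_mem_of_mapsTo` with `S :=` the real form): for
`‖jE B‖ < ε`, `D̃ (jE B) ∈ range jF`. [folklore] -/
theorem Dt_real_mem_range (hCq : QuadAnalytic Ct C₂ R) (hC₂ : 0 ≤ C₂) (hb : 0 ≤ b)
    (hHop : ∀ X, ‖hop X‖ ≤ b * ‖X‖) (hq : 9 * C₂ * b * ε < 1) (hRC : 3 * ε ≤ R)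
    (hDball : ∀ B : 𝒴, ‖B‖ < ε → Dt B ∈ closedBall (0:𝒳) (4 * C₂ * ε ^ 2))
    (hDfix : ∀ B : 𝒴, ‖B‖ < ε → Ct (B - hop (Dt B)) = Dt B)
    (hpF : ∀ x, pF (jF x) = x) (hh : ∀ x, hop (jF x) = jE (h x)) (hC : ∀ y, Ct (jE y) = jF (Ctr y))
    {B : E} (hB : ‖jE B‖ < ε) : Dt (jE B) ∈ range (jF : F → 𝒳) :=
  Dt_mem_of_mapsTo hCq hC₂ hb hHop hq hRC hDball hDfix hB (isClosed_range hpF) ⟨0, map_zero jF⟩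
    fun _ _ hX => mapsTo_realForm hh hC B hX

/-- The real read-out of `D̃` re-embeds to `D̃`: `jF (pF (D̃ (jE B))) = D̃ (jE B)` on the real window. [folklore] -/
theorem jF_realDt (hCq : QuadAnalytic Ct C₂ R) (hC₂ : 0 ≤ C₂) (hb : 0 ≤ b)
    (hHop : ∀ X, ‖hop X‖ ≤ b * ‖X‖) (hq : 9 * C₂ * b * ε < 1) (hRC : 3 * ε ≤ R)
    (hDball : ∀ B : 𝒴, ‖B‖ < ε → Dt B ∈ closedBall (0:𝒳) (4 * C₂ * ε ^ 2))
    (hDfix : ∀ B : 𝒴, ‖B‖ < ε → Ct (B - hop (Dt B)) = Dt B)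
    (hpF : ∀ x, pF (jF x) = x) (hh : ∀ x, hop (jF x) = jE (h x)) (hC : ∀ y, Ct (jE y) = jF (Ctr y))
    {B : E} (hB : ‖jE B‖ < ε) : jF (pF (Dt (jE B))) = Dt (jE B) :=
  jF_pF_of_mem hpF (Dt_real_mem_range hCq hC₂ hb hHop hq hRC hDball hDfix hpF hh hC hB)

/-- **THE REAL FIXED-POINT EQUATION** — row S33's `hfix` for the real map `Dtr := pF ∘ D̃ ∘ jE`: on the real window
`‖jE B‖ < ε`, `Ctr (B − h (Dtr B)) = Dtr B` («The function D̃(B) is determined by the equation …», read on REAL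
fields). [folklore] -/
theorem realDt_fixedPt (hCq : QuadAnalytic Ct C₂ R) (hC₂ : 0 ≤ C₂) (hb : 0 ≤ b)
    (hHop : ∀ X, ‖hop X‖ ≤ b * ‖X‖) (hq : 9 * C₂ * b * ε < 1) (hRC : 3 * ε ≤ R)
    (hDball : ∀ B : 𝒴, ‖B‖ < ε → Dt B ∈ closedBall (0:𝒳) (4 * C₂ * ε ^ 2))
    (hDfix : ∀ B : 𝒴, ‖B‖ < ε → Ct (B - hop (Dt B)) = Dt B)
    (hpF : ∀ x, pF (jF x) = x) (hh : ∀ x, hop (jF x) = jE (h x)) (hC : ∀ y, Ct (jE y) = jF (Ctr y))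
    {B : E} (hB : ‖jE B‖ < ε) : Ctr (B - h (pF (Dt (jE B)))) = pF (Dt (jE B)) := by
  apply jF_injective hpF
  have hre := jF_realDt hCq hC₂ hb hHop hq hRC hDball hDfix hpF hh hC hB
  rw [← hC, map_sub, ← hh, hre, hDfix _ hB]

/-- **THE QUADRATIC BOUND, REAL FORM**: `‖jF (Dtr B)‖ ≤ 4C₂‖jE B‖²` («expansion beginning with quadratic terms»;
`B12Lineariz267.norm_Dt_le` BY NAME). [folklore] -/
theorem norm_jF_realDt_le (hCq : QuadAnalytic Ct C₂ R) (hC₂ : 0 ≤ C₂) (hb : 0 ≤ b)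
    (hHop : ∀ X, ‖hop X‖ ≤ b * ‖X‖) (hq : 9 * C₂ * b * ε < 1) (hRC : 3 * ε ≤ R)
    (hDball : ∀ B : 𝒴, ‖B‖ < ε → Dt B ∈ closedBall (0:𝒳) (4 * C₂ * ε ^ 2))
    (hDfix : ∀ B : 𝒴, ‖B‖ < ε → Ct (B - hop (Dt B)) = Dt B)
    (hpF : ∀ x, pF (jF x) = x) (hh : ∀ x, hop (jF x) = jE (h x)) (hC : ∀ y, Ct (jE y) = jF (Ctr y))
    {B : E} (hB : ‖jE B‖ < ε) : ‖jF (pF (Dt (jE B)))‖ ≤ 4 * C₂ * ‖jE B‖ ^ 2 := by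
  rw [jF_realDt hCq hC₂ hb hHop hq hRC hDball hDfix hpF hh hC hB]
  exact norm_Dt_le hCq hC₂ hb hHop hq hRC hDball hDfix hB

/-- **UNIQUENESS AMONG REAL SOLUTIONS**: a real `X` with `‖jF X‖ ≤ 4C₂ε²` solving `Ctr (B − hX) = X` at a point of the
real window IS `pF (D̃ (jE B))` («exactly one solution»; `B12Lineariz267.eq_Dt_of_fixedPt` BY NAME). [folklore] -/
theorem realDt_unique (hCq : QuadAnalytic Ct C₂ R) (hC₂ : 0 ≤ C₂) (hb : 0 ≤ b)
    (hHop : ∀ X, ‖hop X‖ ≤ b * ‖X‖) (hq : 9 * C₂ * b * ε < 1) (hRC : 3 * ε ≤ R)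
    (hDball : ∀ B : 𝒴, ‖B‖ < ε → Dt B ∈ closedBall (0:𝒳) (4 * C₂ * ε ^ 2))
    (hDfix : ∀ B : 𝒴, ‖B‖ < ε → Ct (B - hop (Dt B)) = Dt B)
    (hpF : ∀ x, pF (jF x) = x) (hh : ∀ x, hop (jF x) = jE (h x)) (hC : ∀ y, Ct (jE y) = jF (Ctr y))
    {B : E} (hB : ‖jE B‖ < ε) {X : F} (hXball : ‖jF X‖ ≤ 4 * C₂ * ε ^ 2)
    (hXfix : Ctr (B - h X) = X) : X = pF (Dt (jE B)) := by
  have hmem : jF X ∈ closedBall (0:𝒳) (4 * C₂ * ε ^ 2) := by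
    rwa [mem_closedBall, dist_zero_right]
  have hfixC : Ct (jE B - hop (jF X)) = jF X := by
    rw [hh, ← map_sub, hC, hXfix]
  have := eq_Dt_of_fixedPt hCq hC₂ hb hHop hq hRC hDball hDfix hB hmem hfixC
  rw [← hpF X, this]

/-- **THE REAL SUBSTITUTION IS INJECTIVE ON THE REAL WINDOW** — row S33's `substitution_injOn` BY NAME, fed with the
real fixed-point equation. [folklore] -/
theorem real_substitution_injOn (hCq : QuadAnalytic Ct C₂ R) (hC₂ : 0 ≤ C₂) (hb : 0 ≤ b)
    (hHop : ∀ X, ‖hop X‖ ≤ b * ‖X‖) (hq : 9 * C₂ * b * ε < 1) (hRC : 3 * ε ≤ R)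
    (hDball : ∀ B : 𝒴, ‖B‖ < ε → Dt B ∈ closedBall (0:𝒳) (4 * C₂ * ε ^ 2))
    (hDfix : ∀ B : 𝒴, ‖B‖ < ε → Ct (B - hop (Dt B)) = Dt B)
    (hpF : ∀ x, pF (jF x) = x) (hh : ∀ x, hop (jF x) = jE (h x)) (hC : ∀ y, Ct (jE y) = jF (Ctr y)) :
    InjOn (fun B : E => B - h (pF (Dt (jE B)))) {B : E | ‖jE B‖ < ε} :=
  ShellMeasureLinearizedConstraint.substitution_injOn h Ctr (fun B => pF (Dt (jE B)))
    fun _ hB => realDt_fixedPt hCq hC₂ hb hHop hq hRC hDball hDfix hpF hh hC hB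

/-- **THE REAL SUBSTITUTION LINEARIZES THE REAL AVERAGE**: with a real `L : E →L[ℝ] F` and «LQ̃h = I» over `ℝ`,
`L (B − h (Dtr B)) + Ctr (B − h (Dtr B)) = L B` on the real window (`B12Lineariz267.linearizes` over the ring `ℝ`
BY NAME).  No intertwining of `L` with the complex `LQ̃` is needed for this identity. [folklore] -/
theorem real_substitution_linearizes (hCq : QuadAnalytic Ct C₂ R) (hC₂ : 0 ≤ C₂) (hb : 0 ≤ b)
    (hHop : ∀ X, ‖hop X‖ ≤ b * ‖X‖) (hq : 9 * C₂ * b * ε < 1) (hRC : 3 * ε ≤ R)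
    (hDball : ∀ B : 𝒴, ‖B‖ < ε → Dt B ∈ closedBall (0:𝒳) (4 * C₂ * ε ^ 2))
    (hDfix : ∀ B : 𝒴, ‖B‖ < ε → Ct (B - hop (Dt B)) = Dt B)
    (hpF : ∀ x, pF (jF x) = x) (hh : ∀ x, hop (jF x) = jE (h x)) (hC : ∀ y, Ct (jE y) = jF (Ctr y))
    (L : E →L[ℝ] F) (hLh : ∀ x, L (h x) = x) {B : E} (hB : ‖jE B‖ < ε) :
    L (B - h (pF (Dt (jE B)))) + Ctr (B - h (pF (Dt (jE B)))) = L B :=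
  B12Lineariz267.linearizes (LQ := (L : E →ₗ[ℝ] F)) (hop := (h : F →ₗ[ℝ] E)) (Ct := Ctr) hLh
    (realDt_fixedPt hCq hC₂ hb hHop hq hRC hDball hDfix hpF hh hC hB)

end RealFixedPoint

/-! ## §3 The real Fréchet derivative of `pF ∘ D̃ ∘ jE` -/

section RealDerivative

variable [CompleteSpace 𝒴]
variable {hop : 𝒳 →ₗ[ℂ] 𝒴} {Ct : 𝒴 → 𝒳} {C₂ R b ε : ℝ} {Dt : 𝒴 → 𝒳}
  {jE : E →L[ℝ] 𝒴} {jF : F →L[ℝ] 𝒳} {pF : 𝒳 →L[ℝ] F}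

/-- **THE REAL DERIVATIVE OF `D̃` READ ON REAL FIELDS.**  Under the hypotheses of
`B12LinearizAnalytic267.hasStrictFDerivAt_Dt` (`C̃` analytic on `‖Y‖ < R`, both spaces complete), at every point of
the real window the real map `B ↦ pF (D̃ (jE B))` has Fréchet derivative OVER `ℝ`
`pF ∘L (DD̃(jE B)).restrictScalars ℝ ∘L jE`, `DD̃(B₀) = (I + DC̃(Y₀)h)⁻¹ DC̃(Y₀)`, `Y₀ = B₀ − hD̃(B₀)` — the operator
under «Tr log» in (2.12), read on the real form (chain rule + `HasFDerivAt.restrictScalars`).  No reality hypothesis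
on `C̃`, `h` is needed for this formula. [folklore] -/
theorem hasFDerivAt_realDt (hCq : QuadAnalytic Ct C₂ R) (hCa : AnalyticOnNhd ℂ Ct {Y : 𝒴 | ‖Y‖ < R})
    (hC₂ : 0 ≤ C₂) (hb : 0 ≤ b) (hHop : ∀ X, ‖hop X‖ ≤ b * ‖X‖) (hq : 9 * C₂ * b * ε < 1) (hRC : 3 * ε ≤ R)
    (hDball : ∀ B : 𝒴, ‖B‖ < ε → Dt B ∈ closedBall (0:𝒳) (4 * C₂ * ε ^ 2))
    (hDfix : ∀ B : 𝒴, ‖B‖ < ε → Ct (B - hop (Dt B)) = Dt B) {B : E} (hB : ‖jE B‖ < ε) :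
    HasFDerivAt (fun B : E => pF (Dt (jE B)))
      (pF ∘L
        (((ContinuousLinearMap.id ℂ 𝒳 + fderiv ℂ Ct (jE B - hop (Dt (jE B))) ∘L hop.mkContinuous b hHop).inverse
            ∘L fderiv ℂ Ct (jE B - hop (Dt (jE B)))).restrictScalars ℝ) ∘L jE) B := by
  have hD := (hasStrictFDerivAt_Dt hCq hCa hC₂ hb hHop hq hRC hDball hDfix hB).hasFDerivAt.restrictScalars ℝ
  exact pF.hasFDerivAt.comp B (hD.comp B jE.hasFDerivAt)

/-- `HasFDerivWithinAt` form on the real window `{B | ‖jE B‖ < ε}` — row S33's input `hD` of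
`ShellMeasureLinearizedConstraint.substitution_hasFDerivWithinAt`. [folklore] -/
theorem hasFDerivWithinAt_realDt (hCq : QuadAnalytic Ct C₂ R) (hCa : AnalyticOnNhd ℂ Ct {Y : 𝒴 | ‖Y‖ < R})
    (hC₂ : 0 ≤ C₂) (hb : 0 ≤ b) (hHop : ∀ X, ‖hop X‖ ≤ b * ‖X‖) (hq : 9 * C₂ * b * ε < 1) (hRC : 3 * ε ≤ R)
    (hDball : ∀ B : 𝒴, ‖B‖ < ε → Dt B ∈ closedBall (0:𝒳) (4 * C₂ * ε ^ 2))
    (hDfix : ∀ B : 𝒴, ‖B‖ < ε → Ct (B - hop (Dt B)) = Dt B) {B : E} (hB : ‖jE B‖ < ε) :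
    HasFDerivWithinAt (fun B : E => pF (Dt (jE B)))
      (pF ∘L
        (((ContinuousLinearMap.id ℂ 𝒳 + fderiv ℂ Ct (jE B - hop (Dt (jE B))) ∘L hop.mkContinuous b hHop).inverse
            ∘L fderiv ℂ Ct (jE B - hop (Dt (jE B)))).restrictScalars ℝ) ∘L jE) {B : E | ‖jE B‖ < ε} B :=
  (hasFDerivAt_realDt hCq hCa hC₂ hb hHop hq hRC hDball hDfix hB).hasFDerivWithinAt

/-- **THE REAL SUBSTITUTION'S DERIVATIVE** `id − h ∘ D(Dtr)` within the real window — row S33's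
`substitution_hasFDerivWithinAt` BY NAME (print's «I − h(δ/δB)D̃», real form). [folklore] -/
theorem hasFDerivWithinAt_real_substitution (hCq : QuadAnalytic Ct C₂ R)
    (hCa : AnalyticOnNhd ℂ Ct {Y : 𝒴 | ‖Y‖ < R}) (hC₂ : 0 ≤ C₂) (hb : 0 ≤ b)
    (hHop : ∀ X, ‖hop X‖ ≤ b * ‖X‖) (hq : 9 * C₂ * b * ε < 1) (hRC : 3 * ε ≤ R)
    (hDball : ∀ B : 𝒴, ‖B‖ < ε → Dt B ∈ closedBall (0:𝒳) (4 * C₂ * ε ^ 2))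
    (hDfix : ∀ B : 𝒴, ‖B‖ < ε → Ct (B - hop (Dt B)) = Dt B) (h : F →L[ℝ] E) {B : E} (hB : ‖jE B‖ < ε) :
    HasFDerivWithinAt (fun B : E => B - h (pF (Dt (jE B))))
      (ContinuousLinearMap.id ℝ E - h.comp (pF ∘L
        (((ContinuousLinearMap.id ℂ 𝒳 + fderiv ℂ Ct (jE B - hop (Dt (jE B))) ∘L hop.mkContinuous b hHop).inverse
            ∘L fderiv ℂ Ct (jE B - hop (Dt (jE B)))).restrictScalars ℝ) ∘L jE)) {B : E | ‖jE B‖ < ε} B :=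
  ShellMeasureLinearizedConstraint.substitution_hasFDerivWithinAt h (fun B => pF (Dt (jE B)))
    (hasFDerivWithinAt_realDt hCq hCa hC₂ hb hHop hq hRC hDball hDfix hB)

end RealDerivative

/-! ## §4 THE END: one real `D̃` on the real window from the complex leaf + the real structure -/

section End

variable [CompleteSpace 𝒴]
variable {hop : 𝒳 →ₗ[ℂ] 𝒴} {Ct : 𝒴 → 𝒳} {C₂ R b ε : ℝ}
  {jE : E →L[ℝ] 𝒴} {jF : F →L[ℝ] 𝒳} {pF : 𝒳 →L[ℝ] F} {h : F →L[ℝ] E} {Ctr : E → F}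

/-- **THE REAL-FORM JUNCTION FOR (LR)_j.**  From the COMPLEX hypotheses of `B12Lineariz267.exists_Dt` (complex Banach
spaces `𝒴`, `𝒳`; `QuadAnalytic C̃ C₂ R`, `C̃` analytic on `‖Y‖ < R`; `‖hX‖ ≤ b‖X‖`; `9C₂bε < 1`, `3ε ≤ R`) and a REAL
STRUCTURE (real normed `E`, `F`; inclusions `jE`, `jF`; a retraction `pF` of `jF`; real `h`, `Ctr` intertwined with
`h`, `C̃`): there is ONE real map `Dtr : E → F` such that on the real window `‖jE B‖ < ε`
(i) `Ctr (B − h (Dtr B)) = Dtr B` — row S33's `hfix`; (ii) `‖jF (Dtr B)‖ ≤ 4C₂‖jE B‖²`; (iii) `jF (Dtr B)` is the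
complex leaf's `D̃ (jE B)` for a complex solution `D̃` on `‖·‖ < ε`; (iv) `Dtr` has a real Fréchet derivative within
the window of the form `pF ∘L D.restrictScalars ℝ ∘L jE` with `D` a continuous COMPLEX-linear map (the leaf's
`DD̃(jE B)`).  CONDITIONAL on every hypothesis; nothing printed asserted. [folklore] -/
theorem exists_realDt (hCq : QuadAnalytic Ct C₂ R) (hCa : AnalyticOnNhd ℂ Ct {Y : 𝒴 | ‖Y‖ < R})
    (hC₂ : 0 ≤ C₂) (hb : 0 ≤ b) (hHop : ∀ X, ‖hop X‖ ≤ b * ‖X‖) (hq : 9 * C₂ * b * ε < 1) (hRC : 3 * ε ≤ R)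
    (hpF : ∀ x, pF (jF x) = x) (hh : ∀ x, hop (jF x) = jE (h x)) (hC : ∀ y, Ct (jE y) = jF (Ctr y)) :
    ∃ Dtr : E → F, ∃ Dt : 𝒴 → 𝒳,
      (∀ Y : 𝒴, ‖Y‖ < ε → Dt Y ∈ closedBall (0:𝒳) (4 * C₂ * ε ^ 2) ∧ Ct (Y - hop (Dt Y)) = Dt Y) ∧
      ∀ B : E, ‖jE B‖ < ε →
        Ctr (B - h (Dtr B)) = Dtr B ∧ ‖jF (Dtr B)‖ ≤ 4 * C₂ * ‖jE B‖ ^ 2 ∧ jF (Dtr B) = Dt (jE B) ∧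
        ∃ D : 𝒴 →L[ℂ] 𝒳,
          HasFDerivWithinAt Dtr (pF ∘L D.restrictScalars ℝ ∘L jE) {B : E | ‖jE B‖ < ε} B := by
  obtain ⟨Dt, hDt⟩ := exists_Dt hCq hC₂ hb hHop hq hRC
  have hDball : ∀ B : 𝒴, ‖B‖ < ε → Dt B ∈ closedBall (0:𝒳) (4 * C₂ * ε ^ 2) := fun B hB => (hDt B hB).1
  have hDfix : ∀ B : 𝒴, ‖B‖ < ε → Ct (B - hop (Dt B)) = Dt B := fun B hB => (hDt B hB).2
  refine ⟨fun B => pF (Dt (jE B)), Dt, hDt, fun B hB => ⟨?_, ?_, ?_, ?_⟩⟩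
  · exact realDt_fixedPt hCq hC₂ hb hHop hq hRC hDball hDfix hpF hh hC hB
  · exact norm_jF_realDt_le hCq hC₂ hb hHop hq hRC hDball hDfix hpF hh hC hB
  · exact jF_realDt hCq hC₂ hb hHop hq hRC hDball hDfix hpF hh hC hB
  · exact ⟨_, hasFDerivWithinAt_realDt hCq hCa hC₂ hb hHop hq hRC hDball hDfix hB⟩

/-- **… WITH A NORM-PRESERVING INCLUSION THE REAL WINDOW IS LITERALLY THE BALL `‖B‖ < ε`** and the bound reads
`‖Dtr B‖ ≤ 4C₂‖B‖²` when `jF` preserves norms too (print's real small-field window). [folklore] -/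
theorem exists_realDt_ball (hCq : QuadAnalytic Ct C₂ R) (hCa : AnalyticOnNhd ℂ Ct {Y : 𝒴 | ‖Y‖ < R})
    (hC₂ : 0 ≤ C₂) (hb : 0 ≤ b) (hHop : ∀ X, ‖hop X‖ ≤ b * ‖X‖) (hq : 9 * C₂ * b * ε < 1) (hRC : 3 * ε ≤ R)
    (hpF : ∀ x, pF (jF x) = x) (hh : ∀ x, hop (jF x) = jE (h x)) (hC : ∀ y, Ct (jE y) = jF (Ctr y))
    (hjE : ∀ B, ‖jE B‖ = ‖B‖) (hjF : ∀ x, ‖jF x‖ = ‖x‖) :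
    ∃ Dtr : E → F, ∀ B : E, ‖B‖ < ε →
      Ctr (B - h (Dtr B)) = Dtr B ∧ ‖Dtr B‖ ≤ 4 * C₂ * ‖B‖ ^ 2 ∧
        ∃ D : 𝒴 →L[ℂ] 𝒳, HasFDerivWithinAt Dtr (pF ∘L D.restrictScalars ℝ ∘L jE) (ball (0 : E) ε) B := by
  obtain ⟨Dtr, Dt, -, hDtr⟩ := exists_realDt hCq hCa hC₂ hb hHop hq hRC hpF hh hC
  have hwin : {B : E | ‖jE B‖ < ε} = ball (0 : E) ε := by
    ext B; simp [hjE]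
  refine ⟨Dtr, fun B hB => ?_⟩
  have hB' : ‖jE B‖ < ε := by rwa [hjE]
  obtain ⟨hfix, hbd, -, D, hD⟩ := hDtr B hB'
  refine ⟨hfix, ?_, D, ?_⟩
  · rwa [hjF, hjE] at hbd
  · rwa [hwin] at hD

end End

end Summit.QuantumFields.BalabanUV.T4Continuum.ShellMeasureLinearizedReal

end
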